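import Summits.ResolutionOfSingularities.ResolutionOfSingularities.Theorems.PurelyInseparableDim4ResConeDInfVirtualChain
import Summits.ResolutionOfSingularities.ResolutionOfSingularities.Theorems.PurelyInseparableDim4ResConeDInfTT
import Summits.ResolutionOfSingularities.ResolutionOfSingularities.Theorems.PurelyInseparableDim4TschirnhausChain
import HarnessLib
import HarnessLib.Audit.Tags

/-!
# Purely inseparable four-folds — hN4-D FROM ITS ONE-STEP LEMMA: the D∞ `(5,4)` pair-confinement re-presentation assembled from
# res-dim4-typ-1 g4's virtual-step binder `hVS` and entry binder `hE0` (K2(p) lane, SLICE C, hN4-D file F5-ABSTRACT;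
# file-holder res-dim4-p-5 g5)

[OURS · counted 0 · cell `res-dim4-pi` · K2(p) lane, slice C (res-dim4-typ-1 g4's hN4-D design of record, bus 2026-08-29
07:44:53Z; INVARIANT TEXT + `hVS` + `dInfInv_refl` shapes = bus 07:53:52Z, written out VERBATIM below) · seat p-5 g5.]
Nothing here proves hN4-D, TAIL-D, K2(p)/K2(5), `NoIsolatedTrap p p` or resolution of singularities in dimension ≥ 4 / char. `p`
— NOT proved; every theorem is CONDITIONAL on the two binders `hE0` (= typ-1's `SwapTransport.dInfInv_refl`) and `hVS`
(= typ-1's `SwapTransport.dInf_virtual_step`, file F4).  AI kernel work, weaker than expert review.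

THE INVARIANT `INV a a′ A B π` (typ-1 g4, literal; `A` real state, `B` virtual state, `π` virtual ↦ real letters): `B.r = A.r ∘ π`
supported on the pair `{a, a′}`, equal order and shade, `x^{B.r} ∣ B.F`, `B` isolated with `e_G = 2` and TT for `{a, a′}`, and a
COHERENT FAMILY of origin-fixing frames `Θ M` (slot form on the boundary letters, invertible tangent) with
`B.F = clean₅(U⁵ · Θ_M(A.F)) + E`, `E ∈ 𝔪₀ᴹ`, for every precision `M`.
* `dInf_exists_two_visit` — `(2)`-states beyond every index (W₄ dock);
* **`dInf_representation_of (hE0) (hVS)`** — on a D∞ tail (socket binders verbatim): ENTRY at the `(2,1)`-state `kₑ = k + 2` after a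
  `(2)`-visit beyond the `dInf_tt` threshold (res-dim4-p-5 g5 `…DInfTT` p707227: TT for the boundary pair `{j k, j (k+1)}`, pair
  shape by `dInf_two_visit`, clean by `FrameChange.deletePthPowers_step_F`) through `hE0` with `π = 1`; then
  `…DInfVirtualChain.dInf_virtual_chain` with `Inv t B := ∃ π, INV a a′ (c (kₑ + t)) B π`, the STEP clause being `hVS` fed with
  the real-side data of the tail (`o_k = |r_k| + 4 ∈ {6, 7}`, shade `4`, isolation, `e_G = 2`, `x^r ∣ F`); conclusion = the
  ∃-conclusion of the hN4-D binder of `ResCone.no_dInf_tail_of_representation` (p703603) VERBATIM;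
* **`no_dInf_tail_of (hE0) (hVS)`** — hence the D∞ branch is EMPTY given the two binders (`no_pair_tail_four_five`);
* **`dInf_pairConfined_representation_of (hE0) (hVS)`** — the hN4-D binder itself as a ∀-statement.
So typ-1's F5 is `… := dInf_pairConfined_representation_of dInfInv_refl dInf_virtual_step`.
[cite: CossartJannsenSaito2020, Thm. 3.14] [cite: Hauser2010, §§F–G (chart expressions of a point blowup; cleaning)]
bears_on: LADDER-RESOLUTION:D157-DOOR2 (res-dim4-pi · K2(p) = `RidgeBudget.NoAboveFloorTrap p p` · slice C, TAIL-D `(5,4)` D∞ class, hN4-D F5).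
Supports stmt-ResolutionOfSingularities-16155 (helper).
-/

set_option linter.dupNamespace false -- mandated namespace of this single-conjunct summit

noncomputable section

namespace Summit.ResolutionOfSingularities.ResolutionOfSingularities.Theorems.PIDim4

namespace ResCone

open MvPolynomial Finset
open Literature.AlgebraicGeometry.Resolution
open Literature.AlgebraicGeometry.Resolution.CentreBlowup
open Literature.AlgebraicGeometry.Resolution.Hauser2010
open Literature.AlgebraicGeometry.Resolution.HauserPerlega2019

variable {K : Type} [Field K] [CharP K 5] [DecidableEq K]

/-- **`(2)`-VISITS BEYOND EVERY INDEX** on a constant-shade-`4` tail at `p = 5` (W₄ `no_four_tail_of_degree_two_budget` with budget `0`).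
[OURS · W₄ bookkeeping] [cite: CossartJannsenSaito2020, Thm. 3.14] -/
theorem dInf_exists_two_visit {c : ℕ → State K} {j : ℕ → Fin 4} {b : ℕ → Fin 4 → K}
    (hc : ∀ k, IsIsolated 5 (c k).F ∧ Step0 5 (c k) (c (k + 1))) (hw : FreeTail.IsWitnessedChain 5 c j b)
    (hr0 : ∀ e ∈ (c 0).F.support, (c 0).r ≤ e) (hfloor : ∀ k, ordZero (c k).F ≠ (5 : ℕ)) {k₀ : ℕ}
    (hshade : ∀ k, k₀ ≤ k → (c k).shade = ((4 : ℕ) : ℕ∞)) {N : ℕ} (hN : k₀ ≤ N) :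
    ∃ k, N ≤ k ∧ (c (k + 1)).r.degree = 2 := by
  classical
  have hfloor' : ∀ k, ordZero (c k).F ≠ 5 := fun k => by exact_mod_cast hfloor k
  by_contra hno
  push Not at hno
  refine no_four_tail_of_degree_two_budget hc hw hr0 hfloor' hshade (k₁ := N + 1) (by omega) (B := 0) fun n => ?_
  rw [Nat.le_zero, Finset.card_eq_zero, Finset.filter_eq_empty_iff]
  intro i _
  rw [show N + 1 + i = N + i + 1 by ring]
  exact hno (N + i) (by omega)

/-- **hN4-D FROM THE ENTRY AND ONE-STEP BINDERS.**  On a witnessed isolated above-floor `Step0 5` chain with `x^{r₀} ∣ F₀`, constant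
shade `4` and `e_G ≡ 2` from `k₀`, in the D∞ branch from `k₁ ≥ k₀` (W₄ `four_weights_dichotomy`, binder verbatim): given typ-1 g4's
entry lemma `hE0` (`INV a a′ A A 1` at a clean pair-shaped TT state) and virtual-step lemma `hVS` (`INV` passes along every real step
to SOME virtual step charted in the pair), there is a witnessed isolated above-floor `Step0 5` chain with `x^{r₀} ∣ F₀`, constant
shade `4`, `e_G ≡ 2`, chart letters in a pair and the other two letters never boundary — the ∃-conclusion of the hN4-D binder of
`no_dInf_tail_of_representation`. [OURS · conditional on `hE0`, `hVS`] [cite: CossartJannsenSaito2020, Thm. 3.14]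
[cite: Hauser2010, §§F–G (chart expressions of a point blowup; cleaning)] -/
theorem dInf_representation_of
    (hE0 : ∀ (a a' : Fin 4), a ≠ a' → ∀ (A : State K), deletePthPowers 5 A.F = A.F → (∀ d ∈ A.F.support, A.r ≤ d) →
      (∀ i, i ≠ a → i ≠ a' → A.r i = 0) → IsIsolated 5 A.F → Module.finrank K (ResCone.resVertex A) = 2 →
      (∀ v ∈ ResCone.resVertex A, v a = 0 → v a' = 0 → v = 0) →
      (A.r = Finsupp.mapDomain (Equiv.symm (1 : Equiv.Perm (Fin 4))) A.r ∧
        (∀ i, i ≠ a → i ≠ a' → A.r i = 0) ∧ ordZero A.F = ordZero A.F ∧ A.shade = A.shade ∧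
        (∀ d ∈ A.F.support, A.r ≤ d) ∧ IsIsolated 5 A.F ∧ Module.finrank K (ResCone.resVertex A) = 2 ∧
        (∀ v ∈ ResCone.resVertex A, v a = 0 → v a' = 0 → v = 0) ∧
        ∃ (Θ e : ℕ → Fin 4 → MvPolynomial (Fin 4) K), (∀ M k, Θ (M + 1) k - Θ M k ∈ originIdeal K ^ (M + 2)) ∧
          ∀ M, (∀ k, constantCoeff (Θ M k) = 0) ∧
            (∀ i, A.r i ≠ 0 → Θ M ((1 : Equiv.Perm (Fin 4)) i) = X i * e M i ∧ constantCoeff (e M i) ≠ 0) ∧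
            IsUnit (Matrix.det (Matrix.of fun k m => coeff (Finsupp.single m 1) (Θ M k))) ∧
            ∃ U E : MvPolynomial (Fin 4) K, constantCoeff U ≠ 0 ∧ E ∈ originIdeal K ^ M ∧
              A.F = deletePthPowers 5 (U ^ 5 * aeval (Θ M) A.F) + E))
    (hVS : ∀ (a a' : Fin 4), a ≠ a' → ∀ (A A' B : State K) (π : Equiv.Perm (Fin 4)) (jr : Fin 4) (b : Fin 4 → K),
      b jr = 0 → A' = CentreBlowup.step 5 Finset.univ jr b A → (∀ d ∈ A.F.support, A.r ≤ d) →
      (∀ d ∈ A'.F.support, A'.r ≤ d) → (∃ o : ℕ, ordZero A.F = o ∧ 5 < o ∧ o < 10) →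
      (∃ o' : ℕ, ordZero A'.F = o' ∧ 5 < o' ∧ o' < 10) → A'.shade = A.shade → IsIsolated 5 A'.F →
      Module.finrank K (ResCone.resVertex A') = 2 →
      (B.r = Finsupp.mapDomain (Equiv.symm π) A.r ∧
        (∀ i, i ≠ a → i ≠ a' → B.r i = 0) ∧ ordZero B.F = ordZero A.F ∧ B.shade = A.shade ∧
        (∀ d ∈ B.F.support, B.r ≤ d) ∧ IsIsolated 5 B.F ∧ Module.finrank K (ResCone.resVertex B) = 2 ∧
        (∀ v ∈ ResCone.resVertex B, v a = 0 → v a' = 0 → v = 0) ∧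
        ∃ (Θ e : ℕ → Fin 4 → MvPolynomial (Fin 4) K), (∀ M k, Θ (M + 1) k - Θ M k ∈ originIdeal K ^ (M + 2)) ∧
          ∀ M, (∀ k, constantCoeff (Θ M k) = 0) ∧
            (∀ i, B.r i ≠ 0 → Θ M (π i) = X i * e M i ∧ constantCoeff (e M i) ≠ 0) ∧
            IsUnit (Matrix.det (Matrix.of fun k m => coeff (Finsupp.single m 1) (Θ M k))) ∧
            ∃ U E : MvPolynomial (Fin 4) K, constantCoeff U ≠ 0 ∧ E ∈ originIdeal K ^ M ∧
              B.F = deletePthPowers 5 (U ^ 5 * aeval (Θ M) A.F) + E) →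
      ∃ (ℓ : Fin 4) (β : Fin 4 → K) (π' : Equiv.Perm (Fin 4)), (ℓ = a ∨ ℓ = a') ∧ β ℓ = 0 ∧
      ((CentreBlowup.step 5 Finset.univ ℓ β B).r = Finsupp.mapDomain (Equiv.symm π') A'.r ∧
        (∀ i, i ≠ a → i ≠ a' → (CentreBlowup.step 5 Finset.univ ℓ β B).r i = 0) ∧ ordZero (CentreBlowup.step 5 Finset.univ ℓ β B).F = ordZero A'.F ∧ (CentreBlowup.step 5 Finset.univ ℓ β B).shade = A'.shade ∧
        (∀ d ∈ (CentreBlowup.step 5 Finset.univ ℓ β B).F.support, (CentreBlowup.step 5 Finset.univ ℓ β B).r ≤ d) ∧ IsIsolated 5 (CentreBlowup.step 5 Finset.univ ℓ β B).F ∧ Module.finrank K (ResCone.resVertex (CentreBlowup.step 5 Finset.univ ℓ β B)) = 2 ∧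
        (∀ v ∈ ResCone.resVertex (CentreBlowup.step 5 Finset.univ ℓ β B), v a = 0 → v a' = 0 → v = 0) ∧
        ∃ (Θ e : ℕ → Fin 4 → MvPolynomial (Fin 4) K), (∀ M k, Θ (M + 1) k - Θ M k ∈ originIdeal K ^ (M + 2)) ∧
          ∀ M, (∀ k, constantCoeff (Θ M k) = 0) ∧
            (∀ i, (CentreBlowup.step 5 Finset.univ ℓ β B).r i ≠ 0 → Θ M (π' i) = X i * e M i ∧ constantCoeff (e M i) ≠ 0) ∧
            IsUnit (Matrix.det (Matrix.of fun k m => coeff (Finsupp.single m 1) (Θ M k))) ∧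
            ∃ U E : MvPolynomial (Fin 4) K, constantCoeff U ≠ 0 ∧ E ∈ originIdeal K ^ M ∧
              (CentreBlowup.step 5 Finset.univ ℓ β B).F = deletePthPowers 5 (U ^ 5 * aeval (Θ M) A'.F) + E))
    {c : ℕ → State K} {j : ℕ → Fin 4} {b : ℕ → Fin 4 → K}
    (hc : ∀ k, IsIsolated 5 (c k).F ∧ Step0 5 (c k) (c (k + 1))) (hw : FreeTail.IsWitnessedChain 5 c j b)
    (hr0 : ∀ e ∈ (c 0).F.support, (c 0).r ≤ e) (hfloor : ∀ k, ordZero (c k).F ≠ (5 : ℕ)) (k₀ : ℕ)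
    (hshade : ∀ k, k₀ ≤ k → (c k).shade = ((4 : ℕ) : ℕ∞))
    (he : ∀ k, k₀ ≤ k → Module.finrank K (resVertex (c k)) = 2) (k₁ : ℕ) (hk₁ : k₀ ≤ k₁)
    (hD : ∀ k, k₁ ≤ k → (∃ W, (c k).r W = 2 ∧ ∀ i, i ≠ W → (c k).r i ≤ 1) ∧
      (2 ≤ (c k).r.degree ∧ (c k).r.degree ≤ 3)) :
    ∃ (c' : ℕ → State K) (j' : ℕ → Fin 4) (b' : ℕ → Fin 4 → K) (k₀' : ℕ) (a a' : Fin 4),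
      (∀ k, IsIsolated 5 (c' k).F ∧ Step0 5 (c' k) (c' (k + 1))) ∧ FreeTail.IsWitnessedChain 5 c' j' b' ∧
      (∀ e ∈ (c' 0).F.support, (c' 0).r ≤ e) ∧ (∀ k, ordZero (c' k).F ≠ (5 : ℕ)) ∧
      (∀ k, k₀' ≤ k → (c' k).shade = ((4 : ℕ) : ℕ∞)) ∧
      (∀ k, k₀' ≤ k → Module.finrank K (resVertex (c' k)) = 2) ∧ a ≠ a' ∧
      (∀ k, k₀' ≤ k → (j' k = a ∨ j' k = a')) ∧
      (∀ k, k₀' ≤ k → ∀ i, i ≠ a → i ≠ a' → (c' k).r i = 0) := by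
  haveI : Fact (Nat.Prime 5) := ⟨by norm_num⟩
  have hfloor' : ∀ k, ordZero (c k).F ≠ 5 := fun k => by exact_mod_cast hfloor k
  obtain ⟨hord, -, -, hfl, -⟩ := four_weights_laws hc hw hr0 hfloor' hshade
  have hstep : ∀ k, c (k + 1) = CentreBlowup.step 5 Finset.univ (j k) (b k) (c k) := fun k => (hw k).2.2.2.2
  have hdivk : ∀ k, ∀ d ∈ (c k).F.support, (c k).r ≤ d := IsolatedBand.isolated_chain_forall_le hc hr0
  -- (1) the entry time `kₑ = k + 2`: a `(2,1)`-state after a `(2)`-visit, beyond the `dInf_tt` threshold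
  obtain ⟨k₂, hk₂, hTT⟩ := dInf_tt hc hw hr0 hfloor k₀ hshade he k₁ hk₁ hD
  obtain ⟨k, hk, h2⟩ := dInf_exists_two_visit hc hw hr0 hfloor hshade (N := k₂) (by omega)
  obtain ⟨-, -, -, hW2, hh1, h3, hoth⟩ := dInf_two_visit hc hw hr0 hfloor hshade hk₁ hD (show k₁ ≤ k by omega) h2
  set a : Fin 4 := j k with ha
  set a' : Fin 4 := j (k + 1) with ha'
  have haa' : a ≠ a' := by
    intro h
    rw [h] at hW2
    omega
  have hTTe : ∀ v ∈ resVertex (c (k + 2)), v a = 0 → v a' = 0 → v = 0 := fun v hv hva hva' =>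
    hTT (k + 2) (by omega) h3 v hv fun i hi => by
      by_cases hia : i = a
      · rw [hia]; exact hva
      · by_cases hia' : i = a'
        · rw [hia']; exact hva'
        · have := hoth i hia hia'; omega
  have hclean : deletePthPowers 5 (c (k + 2)).F = (c (k + 2)).F := by
    rw [hstep (k + 1)]
    exact FrameChange.deletePthPowers_step_F 5 Finset.univ (j (k + 1)) (b (k + 1)) (c (k + 1))
  have hentry := hE0 a a' haa' (c (k + 2)) hclean (hdivk (k + 2)) hoth (hc (k + 2)).1 (he (k + 2) (by omega)) hTTe
  -- (2) the abstract virtual chain with `Inv t B := ∃ π, INV a a' (c (k + 2 + t)) B π`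
  obtain ⟨c', j', b', -, -, hc', hw', hr0', hfloorV, hshadeV, heV, hletters, hpass⟩ :=
    dInf_virtual_chain (K := K) (a := a) (a' := a') (B₀ := c (k + 2))
      (Inv := fun t B => ∃ π : Equiv.Perm (Fin 4), (B.r = Finsupp.mapDomain (Equiv.symm π) (c (k + 2 + t)).r ∧
        (∀ i, i ≠ a → i ≠ a' → B.r i = 0) ∧ ordZero B.F = ordZero (c (k + 2 + t)).F ∧ B.shade = (c (k + 2 + t)).shade ∧
        (∀ d ∈ B.F.support, B.r ≤ d) ∧ IsIsolated 5 B.F ∧ Module.finrank K (ResCone.resVertex B) = 2 ∧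
        (∀ v ∈ ResCone.resVertex B, v a = 0 → v a' = 0 → v = 0) ∧
        ∃ (Θ e : ℕ → Fin 4 → MvPolynomial (Fin 4) K), (∀ M k, Θ (M + 1) k - Θ M k ∈ originIdeal K ^ (M + 2)) ∧
          ∀ M, (∀ k, constantCoeff (Θ M k) = 0) ∧
            (∀ i, B.r i ≠ 0 → Θ M (π i) = X i * e M i ∧ constantCoeff (e M i) ≠ 0) ∧
            IsUnit (Matrix.det (Matrix.of fun k m => coeff (Finsupp.single m 1) (Θ M k))) ∧
            ∃ U E : MvPolynomial (Fin 4) K, constantCoeff U ≠ 0 ∧ E ∈ originIdeal K ^ M ∧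
              B.F = deletePthPowers 5 (U ^ 5 * aeval (Θ M) (c (k + 2 + t)).F) + E))
      ⟨1, hentry⟩
      (fun t B hB => by
        obtain ⟨π, hr, hpairB, hoB, -, hdivB, hisoB, heB, -, -⟩ := hB
        have hkt : k₀ ≤ k + 2 + t := by omega
        refine ⟨hisoB, ?_, ?_, heB, hpairB, hdivB⟩
        · rw [hoB, hord (k + 2 + t) hkt, hr, Finsupp.degree_mapDomain]
        · rw [hr, Finsupp.degree_mapDomain]; exact hfl (k + 2 + t) hkt)
      (fun t B hB => by
        obtain ⟨π, hinv⟩ := hB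
        have hkt : k₀ ≤ k + 2 + t := by omega
        have hkt1 : k₀ ≤ k + 2 + t + 1 := by omega
        have ho : ∃ o : ℕ, ordZero (c (k + 2 + t)).F = o ∧ 5 < o ∧ o < 10 := by
          refine ⟨(c (k + 2 + t)).r.degree + 4, hord _ hkt, ?_, ?_⟩
          · have := hfl (k + 2 + t) hkt; omega
          · have := (hD (k + 2 + t) (by omega)).2.2; omega
        have ho' : ∃ o' : ℕ, ordZero (c (k + 2 + t + 1)).F = o' ∧ 5 < o' ∧ o' < 10 := by
          refine ⟨(c (k + 2 + t + 1)).r.degree + 4, hord _ hkt1, ?_, ?_⟩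
          · have := hfl (k + 2 + t + 1) hkt1; omega
          · have := (hD (k + 2 + t + 1) (by omega)).2.2; omega
        have hsh : (c (k + 2 + t + 1)).shade = (c (k + 2 + t)).shade := by
          rw [hshade _ hkt1, hshade _ hkt]
        obtain ⟨ℓ, β, π', hℓ, hβ, hinv'⟩ := hVS a a' haa' (c (k + 2 + t)) (c (k + 2 + t + 1)) B π (j (k + 2 + t))
          (b (k + 2 + t)) (hw (k + 2 + t)).2.1 (hstep (k + 2 + t)) (hdivk _) (hdivk _) ho ho' hsh (hc (k + 2 + t + 1)).1
          (he _ hkt1) hinv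
        exact ⟨ℓ, β, hℓ, hβ, π', hinv'⟩)
  exact ⟨c', j', b', 0, a, a', hc', hw', hr0', hfloorV, hshadeV, heV, haa', hletters, hpass⟩

/-- **THE D∞ BRANCH IS EMPTY GIVEN THE TWO BINDERS** (`dInf_representation_of` + res-dim4-p-5 g4's `no_pair_tail_four_five`).
[OURS · conditional on `hE0`, `hVS`] [cite: CossartJannsenSaito2020, Thm. 3.14] -/
theorem no_dInf_tail_of
    (hE0 : ∀ (a a' : Fin 4), a ≠ a' → ∀ (A : State K), deletePthPowers 5 A.F = A.F → (∀ d ∈ A.F.support, A.r ≤ d) →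
      (∀ i, i ≠ a → i ≠ a' → A.r i = 0) → IsIsolated 5 A.F → Module.finrank K (ResCone.resVertex A) = 2 →
      (∀ v ∈ ResCone.resVertex A, v a = 0 → v a' = 0 → v = 0) →
      (A.r = Finsupp.mapDomain (Equiv.symm (1 : Equiv.Perm (Fin 4))) A.r ∧
        (∀ i, i ≠ a → i ≠ a' → A.r i = 0) ∧ ordZero A.F = ordZero A.F ∧ A.shade = A.shade ∧
        (∀ d ∈ A.F.support, A.r ≤ d) ∧ IsIsolated 5 A.F ∧ Module.finrank K (ResCone.resVertex A) = 2 ∧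
        (∀ v ∈ ResCone.resVertex A, v a = 0 → v a' = 0 → v = 0) ∧
        ∃ (Θ e : ℕ → Fin 4 → MvPolynomial (Fin 4) K), (∀ M k, Θ (M + 1) k - Θ M k ∈ originIdeal K ^ (M + 2)) ∧
          ∀ M, (∀ k, constantCoeff (Θ M k) = 0) ∧
            (∀ i, A.r i ≠ 0 → Θ M ((1 : Equiv.Perm (Fin 4)) i) = X i * e M i ∧ constantCoeff (e M i) ≠ 0) ∧
            IsUnit (Matrix.det (Matrix.of fun k m => coeff (Finsupp.single m 1) (Θ M k))) ∧
            ∃ U E : MvPolynomial (Fin 4) K, constantCoeff U ≠ 0 ∧ E ∈ originIdeal K ^ M ∧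
              A.F = deletePthPowers 5 (U ^ 5 * aeval (Θ M) A.F) + E))
    (hVS : ∀ (a a' : Fin 4), a ≠ a' → ∀ (A A' B : State K) (π : Equiv.Perm (Fin 4)) (jr : Fin 4) (b : Fin 4 → K),
      b jr = 0 → A' = CentreBlowup.step 5 Finset.univ jr b A → (∀ d ∈ A.F.support, A.r ≤ d) →
      (∀ d ∈ A'.F.support, A'.r ≤ d) → (∃ o : ℕ, ordZero A.F = o ∧ 5 < o ∧ o < 10) →
      (∃ o' : ℕ, ordZero A'.F = o' ∧ 5 < o' ∧ o' < 10) → A'.shade = A.shade → IsIsolated 5 A'.F →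
      Module.finrank K (ResCone.resVertex A') = 2 →
      (B.r = Finsupp.mapDomain (Equiv.symm π) A.r ∧
        (∀ i, i ≠ a → i ≠ a' → B.r i = 0) ∧ ordZero B.F = ordZero A.F ∧ B.shade = A.shade ∧
        (∀ d ∈ B.F.support, B.r ≤ d) ∧ IsIsolated 5 B.F ∧ Module.finrank K (ResCone.resVertex B) = 2 ∧
        (∀ v ∈ ResCone.resVertex B, v a = 0 → v a' = 0 → v = 0) ∧
        ∃ (Θ e : ℕ → Fin 4 → MvPolynomial (Fin 4) K), (∀ M k, Θ (M + 1) k - Θ M k ∈ originIdeal K ^ (M + 2)) ∧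
          ∀ M, (∀ k, constantCoeff (Θ M k) = 0) ∧
            (∀ i, B.r i ≠ 0 → Θ M (π i) = X i * e M i ∧ constantCoeff (e M i) ≠ 0) ∧
            IsUnit (Matrix.det (Matrix.of fun k m => coeff (Finsupp.single m 1) (Θ M k))) ∧
            ∃ U E : MvPolynomial (Fin 4) K, constantCoeff U ≠ 0 ∧ E ∈ originIdeal K ^ M ∧
              B.F = deletePthPowers 5 (U ^ 5 * aeval (Θ M) A.F) + E) →
      ∃ (ℓ : Fin 4) (β : Fin 4 → K) (π' : Equiv.Perm (Fin 4)), (ℓ = a ∨ ℓ = a') ∧ β ℓ = 0 ∧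
      ((CentreBlowup.step 5 Finset.univ ℓ β B).r = Finsupp.mapDomain (Equiv.symm π') A'.r ∧
        (∀ i, i ≠ a → i ≠ a' → (CentreBlowup.step 5 Finset.univ ℓ β B).r i = 0) ∧ ordZero (CentreBlowup.step 5 Finset.univ ℓ β B).F = ordZero A'.F ∧ (CentreBlowup.step 5 Finset.univ ℓ β B).shade = A'.shade ∧
        (∀ d ∈ (CentreBlowup.step 5 Finset.univ ℓ β B).F.support, (CentreBlowup.step 5 Finset.univ ℓ β B).r ≤ d) ∧ IsIsolated 5 (CentreBlowup.step 5 Finset.univ ℓ β B).F ∧ Module.finrank K (ResCone.resVertex (CentreBlowup.step 5 Finset.univ ℓ β B)) = 2 ∧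
        (∀ v ∈ ResCone.resVertex (CentreBlowup.step 5 Finset.univ ℓ β B), v a = 0 → v a' = 0 → v = 0) ∧
        ∃ (Θ e : ℕ → Fin 4 → MvPolynomial (Fin 4) K), (∀ M k, Θ (M + 1) k - Θ M k ∈ originIdeal K ^ (M + 2)) ∧
          ∀ M, (∀ k, constantCoeff (Θ M k) = 0) ∧
            (∀ i, (CentreBlowup.step 5 Finset.univ ℓ β B).r i ≠ 0 → Θ M (π' i) = X i * e M i ∧ constantCoeff (e M i) ≠ 0) ∧
            IsUnit (Matrix.det (Matrix.of fun k m => coeff (Finsupp.single m 1) (Θ M k))) ∧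
            ∃ U E : MvPolynomial (Fin 4) K, constantCoeff U ≠ 0 ∧ E ∈ originIdeal K ^ M ∧
              (CentreBlowup.step 5 Finset.univ ℓ β B).F = deletePthPowers 5 (U ^ 5 * aeval (Θ M) A'.F) + E))
    {c : ℕ → State K} {j : ℕ → Fin 4} {b : ℕ → Fin 4 → K}
    (hc : ∀ k, IsIsolated 5 (c k).F ∧ Step0 5 (c k) (c (k + 1))) (hw : FreeTail.IsWitnessedChain 5 c j b)
    (hr0 : ∀ e ∈ (c 0).F.support, (c 0).r ≤ e) (hfloor : ∀ k, ordZero (c k).F ≠ (5 : ℕ)) (k₀ : ℕ)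
    (hshade : ∀ k, k₀ ≤ k → (c k).shade = ((4 : ℕ) : ℕ∞))
    (he : ∀ k, k₀ ≤ k → Module.finrank K (resVertex (c k)) = 2) (k₁ : ℕ) (hk₁ : k₀ ≤ k₁)
    (hD : ∀ k, k₁ ≤ k → (∃ W, (c k).r W = 2 ∧ ∀ i, i ≠ W → (c k).r i ≤ 1) ∧
      (2 ≤ (c k).r.degree ∧ (c k).r.degree ≤ 3)) : False := by
  haveI : Fact (Nat.Prime 5) := ⟨by norm_num⟩
  obtain ⟨c', j', b', k₀', a, a', hc', hw', hr0', hfloorV, hshadeV, heV, haa', hletters, hpass⟩ :=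
    dInf_representation_of hE0 hVS hc hw hr0 hfloor k₀ hshade he k₁ hk₁ hD
  exact no_pair_tail_four_five hc' hw' hr0' (fun t => by exact_mod_cast hfloorV t) hshadeV heV haa' hletters hpass

/-- **THE hN4-D BINDER AS A ∀-STATEMENT, GIVEN THE TWO BINDERS**: exactly the hypothesis `hN4D` of
`ResCone.no_dInf_tail_of_representation` (p703603). [OURS · conditional on `hE0`, `hVS`] [cite: CossartJannsenSaito2020, Thm. 3.14] -/
theorem dInf_pairConfined_representation_of
    (hE0 : ∀ (a a' : Fin 4), a ≠ a' → ∀ (A : State K), deletePthPowers 5 A.F = A.F → (∀ d ∈ A.F.support, A.r ≤ d) →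
      (∀ i, i ≠ a → i ≠ a' → A.r i = 0) → IsIsolated 5 A.F → Module.finrank K (ResCone.resVertex A) = 2 →
      (∀ v ∈ ResCone.resVertex A, v a = 0 → v a' = 0 → v = 0) →
      (A.r = Finsupp.mapDomain (Equiv.symm (1 : Equiv.Perm (Fin 4))) A.r ∧
        (∀ i, i ≠ a → i ≠ a' → A.r i = 0) ∧ ordZero A.F = ordZero A.F ∧ A.shade = A.shade ∧
        (∀ d ∈ A.F.support, A.r ≤ d) ∧ IsIsolated 5 A.F ∧ Module.finrank K (ResCone.resVertex A) = 2 ∧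
        (∀ v ∈ ResCone.resVertex A, v a = 0 → v a' = 0 → v = 0) ∧
        ∃ (Θ e : ℕ → Fin 4 → MvPolynomial (Fin 4) K), (∀ M k, Θ (M + 1) k - Θ M k ∈ originIdeal K ^ (M + 2)) ∧
          ∀ M, (∀ k, constantCoeff (Θ M k) = 0) ∧
            (∀ i, A.r i ≠ 0 → Θ M ((1 : Equiv.Perm (Fin 4)) i) = X i * e M i ∧ constantCoeff (e M i) ≠ 0) ∧
            IsUnit (Matrix.det (Matrix.of fun k m => coeff (Finsupp.single m 1) (Θ M k))) ∧
            ∃ U E : MvPolynomial (Fin 4) K, constantCoeff U ≠ 0 ∧ E ∈ originIdeal K ^ M ∧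
              A.F = deletePthPowers 5 (U ^ 5 * aeval (Θ M) A.F) + E))
    (hVS : ∀ (a a' : Fin 4), a ≠ a' → ∀ (A A' B : State K) (π : Equiv.Perm (Fin 4)) (jr : Fin 4) (b : Fin 4 → K),
      b jr = 0 → A' = CentreBlowup.step 5 Finset.univ jr b A → (∀ d ∈ A.F.support, A.r ≤ d) →
      (∀ d ∈ A'.F.support, A'.r ≤ d) → (∃ o : ℕ, ordZero A.F = o ∧ 5 < o ∧ o < 10) →
      (∃ o' : ℕ, ordZero A'.F = o' ∧ 5 < o' ∧ o' < 10) → A'.shade = A.shade → IsIsolated 5 A'.F →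
      Module.finrank K (ResCone.resVertex A') = 2 →
      (B.r = Finsupp.mapDomain (Equiv.symm π) A.r ∧
        (∀ i, i ≠ a → i ≠ a' → B.r i = 0) ∧ ordZero B.F = ordZero A.F ∧ B.shade = A.shade ∧
        (∀ d ∈ B.F.support, B.r ≤ d) ∧ IsIsolated 5 B.F ∧ Module.finrank K (ResCone.resVertex B) = 2 ∧
        (∀ v ∈ ResCone.resVertex B, v a = 0 → v a' = 0 → v = 0) ∧
        ∃ (Θ e : ℕ → Fin 4 → MvPolynomial (Fin 4) K), (∀ M k, Θ (M + 1) k - Θ M k ∈ originIdeal K ^ (M + 2)) ∧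
          ∀ M, (∀ k, constantCoeff (Θ M k) = 0) ∧
            (∀ i, B.r i ≠ 0 → Θ M (π i) = X i * e M i ∧ constantCoeff (e M i) ≠ 0) ∧
            IsUnit (Matrix.det (Matrix.of fun k m => coeff (Finsupp.single m 1) (Θ M k))) ∧
            ∃ U E : MvPolynomial (Fin 4) K, constantCoeff U ≠ 0 ∧ E ∈ originIdeal K ^ M ∧
              B.F = deletePthPowers 5 (U ^ 5 * aeval (Θ M) A.F) + E) →
      ∃ (ℓ : Fin 4) (β : Fin 4 → K) (π' : Equiv.Perm (Fin 4)), (ℓ = a ∨ ℓ = a') ∧ β ℓ = 0 ∧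
      ((CentreBlowup.step 5 Finset.univ ℓ β B).r = Finsupp.mapDomain (Equiv.symm π') A'.r ∧
        (∀ i, i ≠ a → i ≠ a' → (CentreBlowup.step 5 Finset.univ ℓ β B).r i = 0) ∧ ordZero (CentreBlowup.step 5 Finset.univ ℓ β B).F = ordZero A'.F ∧ (CentreBlowup.step 5 Finset.univ ℓ β B).shade = A'.shade ∧
        (∀ d ∈ (CentreBlowup.step 5 Finset.univ ℓ β B).F.support, (CentreBlowup.step 5 Finset.univ ℓ β B).r ≤ d) ∧ IsIsolated 5 (CentreBlowup.step 5 Finset.univ ℓ β B).F ∧ Module.finrank K (ResCone.resVertex (CentreBlowup.step 5 Finset.univ ℓ β B)) = 2 ∧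
        (∀ v ∈ ResCone.resVertex (CentreBlowup.step 5 Finset.univ ℓ β B), v a = 0 → v a' = 0 → v = 0) ∧
        ∃ (Θ e : ℕ → Fin 4 → MvPolynomial (Fin 4) K), (∀ M k, Θ (M + 1) k - Θ M k ∈ originIdeal K ^ (M + 2)) ∧
          ∀ M, (∀ k, constantCoeff (Θ M k) = 0) ∧
            (∀ i, (CentreBlowup.step 5 Finset.univ ℓ β B).r i ≠ 0 → Θ M (π' i) = X i * e M i ∧ constantCoeff (e M i) ≠ 0) ∧
            IsUnit (Matrix.det (Matrix.of fun k m => coeff (Finsupp.single m 1) (Θ M k))) ∧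
            ∃ U E : MvPolynomial (Fin 4) K, constantCoeff U ≠ 0 ∧ E ∈ originIdeal K ^ M ∧
              (CentreBlowup.step 5 Finset.univ ℓ β B).F = deletePthPowers 5 (U ^ 5 * aeval (Θ M) A'.F) + E)) :
    ∀ (c : ℕ → State K) (j : ℕ → Fin 4) (b : ℕ → Fin 4 → K),
      (∀ k, IsIsolated 5 (c k).F ∧ Step0 5 (c k) (c (k + 1))) → FreeTail.IsWitnessedChain 5 c j b →
      (∀ e ∈ (c 0).F.support, (c 0).r ≤ e) → (∀ k, ordZero (c k).F ≠ (5 : ℕ)) →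
      ∀ k₀ : ℕ, (∀ k, k₀ ≤ k → (c k).shade = ((4 : ℕ) : ℕ∞)) →
      (∀ k, k₀ ≤ k → Module.finrank K (resVertex (c k)) = 2) →
      ∀ k₁ : ℕ, k₀ ≤ k₁ → (∀ k, k₁ ≤ k → (∃ W, (c k).r W = 2 ∧ ∀ i, i ≠ W → (c k).r i ≤ 1) ∧
        (2 ≤ (c k).r.degree ∧ (c k).r.degree ≤ 3)) →
      ∃ (c' : ℕ → State K) (j' : ℕ → Fin 4) (b' : ℕ → Fin 4 → K) (k₀' : ℕ) (a a' : Fin 4),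
      (∀ k, IsIsolated 5 (c' k).F ∧ Step0 5 (c' k) (c' (k + 1))) ∧ FreeTail.IsWitnessedChain 5 c' j' b' ∧
      (∀ e ∈ (c' 0).F.support, (c' 0).r ≤ e) ∧ (∀ k, ordZero (c' k).F ≠ (5 : ℕ)) ∧
      (∀ k, k₀' ≤ k → (c' k).shade = ((4 : ℕ) : ℕ∞)) ∧
      (∀ k, k₀' ≤ k → Module.finrank K (resVertex (c' k)) = 2) ∧ a ≠ a' ∧
      (∀ k, k₀' ≤ k → (j' k = a ∨ j' k = a')) ∧
      (∀ k, k₀' ≤ k → ∀ i, i ≠ a → i ≠ a' → (c' k).r i = 0) :=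
  fun _ _ _ hc hw hr0 hfloor k₀ hshade he k₁ hk₁ hD => dInf_representation_of hE0 hVS hc hw hr0 hfloor k₀ hshade he k₁ hk₁ hD

end ResCone

end Summit.ResolutionOfSingularities.ResolutionOfSingularities.Theorems.PIDim4

end
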